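import Summits.Ventures.Crystal3D.Theorems.StickyWulffConstantTextureBuildRiserEnter
import Summits.Ventures.Crystal3D.Theorems.StickyWulffConstantTextureBuildRiserBoxCells
import Summits.Ventures.Crystal3D.Theorems.StickyWulffConstantTextureBuildRiserSites
import HarnessLib

/-!
# The RISER PACKAGE (B6), part 7: the CLAIM RULE against complete material; layer trichotomy; agreement of the two columns
# (lane T, crux `TextureLiminfV5`, stmt-Ventures-23912; design memo HOME/wulff-p2/g21/B6-DESIGN-g21.md §2 (BX); target `RiserPackage₇` of '…TextureBuildMeshV7')

HONEST FRAMING. Venture `Summits/Ventures/Crystal3D` (cell `crystal3d-full`), route `route-Ventures-StickyWulffConstant`, helper `--supports` the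
law-v5 crux `TextureLiminfV5` (stmt-Ventures-23912).  One-cell lemmas for the box rows of `BoxRow` of the riser input (standard axioms; no mesh constructed).

* `exists_site_dist_sq` — mirror of '…RiserSites' `exists_siteR_dist_sq`: in a riser layer every `g`-site has an `f`-site at squared distance `1/3`;
* `layer_trichotomy` — a height lies in the closed governing window of a RISER layer, or in a slab whose two boundary layers are SHARED;
* **`false_of_claimed_of_complete_rtR`** — an `f`-claimed box cell cannot touch a point near which `g = rtR r` is complete (radius `2`): the occupied riser
  `f`-site of its prism has a `g`-site at distance `1/√3 < 1` (separation);
* **`fst_eq_pm_rn_of_complete_rtL`** — a DEFAULT (`g`-labelled) box cell with a generic boundary point `y` in the closed window of a riser layer, near which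
  `f = rtL r` is complete (radius `1`): the facet datum is horizontal (`p.1 = ± rn r`) — otherwise the cell would ENTER the prism of the occupied site whose
  closed hexagon contains `y` (or of its neighbour across the wall through `y`) and be `f`-claimed;
* `S_inter_ball_eq_of_complete` — if BOTH columns are complete near `y` (radius `4`) their stackings agree on `ball y 3` (riser layers would put two balls at
  distance `1/√3`); `frameWitness` — the frame witness for the agreement lemma («two layerings», '…RiserAxis').
-/

noncomputable section

open scoped BigOperators InnerProductSpace

namespace Summit.Ventures.Crystal3D.Cruxes.TextureLiminf.TexShadow

open Summit.Ventures.Crystal3D Summit.Ventures.Crystal3D.Theorems Set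
open Summit.Ventures.Crystal3D.TentCertificate (hB hB_sq hB_pos)
open Literature.MathematicalPhysics.StatisticalMechanics (haggLabel barlowOffset IsHaggSeq)

namespace Mesh₅

variable {C R₀ : ℝ} {N : ℕ} {x : Fin N → E3} {rc : RiseredCover C R₀ N x} {δ : ℝ} (μ : Mesh₅ rc δ)

/-! ### Mirror packing lemma -/

/-- **In a RISER layer every `g`-site has an `f`-site at squared distance `1/3`.** -/
theorem exists_site_dist_sq {r : Fin rc.nr} {m : ℤ} (hm : ¬ μ.IsSharedLayer r m) (i j : ℤ) :
    ∃ i' j', dist (μ.siteR r m i j) (μ.site r m i' j') ^ 2 = 1 / 3 := by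
  set Δ := haggLabel (μ.rσL r) m - haggLabel (μ.rσR r) m with hΔ
  have hdecomp : haggLabel (μ.rσL r) m = haggLabel (μ.rσR r) m + 3 * (Δ / 3) + Δ % 3 := by omega
  have hmod : Δ % 3 = 0 ∨ Δ % 3 = 1 ∨ Δ % 3 = 2 := by omega
  rcases hmod with h0 | h1 | h2
  · exfalso
    apply hm
    exact μ.isSharedLayer_of_label (q := -(Δ / 3)) (by rw [h0, add_zero] at hdecomp; omega)
  · refine ⟨i - Δ / 3, j - Δ / 3, ?_⟩
    have h := barlowPos_eq_of_haggLabel_eq_add (k := m) (by rw [h1] at hdecomp; exact hdecomp) (i - Δ / 3) (j - Δ / 3)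
    simp only [sub_add_cancel, Int.cast_one, one_smul] at h
    have he : μ.site r m (i - Δ / 3) (j - Δ / 3) = μ.siteR r m i j + μ.rL r (barlowOffset 1) := by
      unfold siteR site; rw [h, map_add]; abel
    rw [he, dist_comm, dist_eq_norm, add_sub_cancel_left, LinearIsometryEquiv.norm_map, norm_barlowOffset_sq]
  · refine ⟨i - Δ / 3 - 1, j - Δ / 3 - 1, ?_⟩
    have hL : haggLabel (μ.rσL r) m = haggLabel (μ.rσR r) m + 3 * (Δ / 3 + 1) + (-1) := by rw [h2] at hdecomp; omega
    have h := barlowPos_eq_of_haggLabel_eq_add (k := m) hL (i - Δ / 3 - 1) (j - Δ / 3 - 1)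
    simp only [show i - Δ / 3 - 1 + (Δ / 3 + 1) = i by ring, show j - Δ / 3 - 1 + (Δ / 3 + 1) = j by ring, Int.cast_neg, Int.cast_one,
      neg_smul, one_smul] at h
    have he : μ.site r m (i - Δ / 3 - 1) (j - Δ / 3 - 1) = μ.siteR r m i j - μ.rL r (barlowOffset 1) := by
      unfold siteR site; rw [h, ← sub_eq_add_neg, map_sub]; abel
    rw [he, dist_eq_norm, sub_sub_cancel, LinearIsometryEquiv.norm_map, norm_barlowOffset_sq]

/-! ### Layer trichotomy -/

/-- **Every height lies in the closed governing window of a riser layer, or in a slab whose two boundary layers are shared.** -/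
theorem layer_trichotomy (r : Fin rc.nr) (h₀ : ℝ) :
    (∃ m, ¬ μ.IsSharedLayer r m ∧ μ.govLo r m ≤ h₀ ∧ h₀ ≤ μ.govHi r m) ∨
      (μ.IsSharedLayer r ⌊h₀ / hB⌋ ∧ μ.IsSharedLayer r (⌊h₀ / hB⌋ + 1)) := by
  set m₀ := ⌊h₀ / hB⌋ with hm₀
  have hh := hB_pos
  have h1 : (m₀ : ℝ) * hB ≤ h₀ := by
    have := Int.floor_le (h₀ / hB)
    calc (m₀ : ℝ) * hB ≤ h₀ / hB * hB := mul_le_mul_of_nonneg_right this hh.le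
      _ = h₀ := div_mul_cancel₀ h₀ hh.ne'
  have h2 : h₀ < ((m₀ : ℝ) + 1) * hB := by
    have := Int.lt_floor_add_one (h₀ / hB)
    calc h₀ = h₀ / hB * hB := (div_mul_cancel₀ h₀ hh.ne').symm
      _ < ((m₀ : ℝ) + 1) * hB := mul_lt_mul_of_pos_right this hh
  by_cases hs0 : μ.IsSharedLayer r m₀
  · by_cases hs1 : μ.IsSharedLayer r (m₀ + 1)
    · exact Or.inr ⟨hs0, hs1⟩
    · refine Or.inl ⟨m₀ + 1, hs1, ?_, ?_⟩
      · have e : μ.govLo r (m₀ + 1) = (m₀ : ℝ) * hB := by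
          unfold govLo; rw [add_sub_cancel_right, if_pos hs0]; push_cast; ring
        rw [e]; exact h1
      · have := (μ.govLo_lt_govHi r (m₀ + 1)).2; push_cast at this; linarith
  · by_cases hle : h₀ ≤ μ.govHi r m₀
    · exact Or.inl ⟨m₀, hs0, by linarith [(μ.govLo_lt_govHi r m₀).1], hle⟩
    · have hle : μ.govHi r m₀ < h₀ := not_le.1 hle
      by_cases hs1 : μ.IsSharedLayer r (m₀ + 1)
      · exfalso
        have e : μ.govHi r m₀ = ((m₀ : ℝ) + 1) * hB := by unfold govHi; rw [if_pos hs1]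
        linarith
      · refine Or.inl ⟨m₀ + 1, hs1, ?_, ?_⟩
        · have e1 : μ.govHi r m₀ = ((m₀ : ℝ) + 1 / 2) * hB := by unfold govHi; rw [if_neg hs1]
          have e2 : μ.govLo r (m₀ + 1) = ((m₀ : ℝ) + 1 / 2) * hB := by
            unfold govLo; rw [add_sub_cancel_right, if_neg hs0]; push_cast; ring
          rw [e2, ← e1]; exact hle.le
        · have := (μ.govLo_lt_govHi r (m₀ + 1)).2; push_cast at this; linarith

/-- The slab of `⌊h₀/hB⌋`: `m₀·hB ≤ h₀ < (m₀+1)·hB`. -/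
theorem floor_slab (h₀ : ℝ) : ((⌊h₀ / hB⌋ : ℤ) : ℝ) * hB ≤ h₀ ∧ h₀ < ((⌊h₀ / hB⌋ : ℤ) + 1 : ℝ) * hB := by
  have hh := hB_pos
  constructor
  · calc ((⌊h₀ / hB⌋ : ℤ) : ℝ) * hB ≤ h₀ / hB * hB := mul_le_mul_of_nonneg_right (Int.floor_le _) hh.le
      _ = h₀ := div_mul_cancel₀ h₀ hh.ne'
  · calc h₀ = h₀ / hB * hB := (div_mul_cancel₀ h₀ hh.ne').symm
      _ < ((⌊h₀ / hB⌋ : ℤ) + 1 : ℝ) * hB := mul_lt_mul_of_pos_right (Int.lt_floor_add_one _) hh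

/-! ### Agreement of the two columns near a doubly complete point -/

include μ in
/-- **Both columns complete near `y` (radius `4`) ⇒ their stackings agree on `ball y 3`.** -/
theorem S_inter_ball_eq_of_complete (r : Fin rc.nr) {y : E3} (hf : ∀ v ∈ rc.S (rc.rtL r), dist y v ≤ 4 → v ∈ rc.X')
    (hg : ∀ v ∈ rc.S (rc.rtR r), dist y v ≤ 4 → v ∈ rc.X') :
    rc.S (rc.rtL r) ∩ Metric.ball y 3 = rc.S (rc.rtR r) ∩ Metric.ball y 3 := by
  ext v
  constructor
  · rintro ⟨hv, hvb⟩
    refine ⟨?_, hvb⟩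
    have hvy : dist v y < 3 := Metric.mem_ball.1 hvb
    obtain ⟨m, a, b, rfl⟩ := μ.exists_eq_site hv
    by_cases hm : μ.IsSharedLayer r m
    · obtain ⟨a', b', e⟩ := μ.exists_siteR_eq_site hm a b
      rw [e]; exact μ.siteR_mem r m a' b'
    · exfalso
      obtain ⟨a', b', hd⟩ := μ.exists_siteR_dist_sq hm a b
      have hd0 := dist_nonneg (x := μ.site r m a b) (y := μ.siteR r m a' b')
      have hvv : dist (μ.site r m a b) (μ.siteR r m a' b') ≤ 1 := by nlinarith
      have hvX := hf _ (μ.site_mem r m a b) (by rw [dist_comm]; linarith)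
      have hv'X := hg _ (μ.siteR_mem r m a' b') (by
        calc dist y (μ.siteR r m a' b') ≤ dist y (μ.site r m a b) + dist (μ.site r m a b) (μ.siteR r m a' b') := dist_triangle _ _ _
          _ ≤ 4 := by rw [dist_comm y]; linarith)
      have hne : μ.site r m a b ≠ μ.siteR r m a' b' := fun h => by rw [h, dist_self] at hd; norm_num at hd
      nlinarith [rc.X'_sep _ hvX _ hv'X hne]
  · rintro ⟨hv, hvb⟩
    refine ⟨?_, hvb⟩
    have hvy : dist v y < 3 := Metric.mem_ball.1 hvb
    obtain ⟨m, a, b, rfl⟩ := μ.exists_eq_siteR hv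
    by_cases hm : μ.IsSharedLayer r m
    · obtain ⟨a', b', e⟩ := μ.exists_site_eq_siteR hm a b
      rw [e]; exact μ.site_mem r m a' b'
    · exfalso
      obtain ⟨a', b', hd⟩ := μ.exists_site_dist_sq hm a b
      have hd0 := dist_nonneg (x := μ.siteR r m a b) (y := μ.site r m a' b')
      have hvv : dist (μ.siteR r m a b) (μ.site r m a' b') ≤ 1 := by nlinarith
      have hvX := hg _ (μ.siteR_mem r m a b) (by rw [dist_comm]; linarith)
      have hv'X := hf _ (μ.site_mem r m a' b') (by
        calc dist y (μ.site r m a' b') ≤ dist y (μ.siteR r m a b) + dist (μ.siteR r m a b) (μ.site r m a' b') := dist_triangle _ _ _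
          _ ≤ 4 := by rw [dist_comm y]; linarith)
      have hne : μ.siteR r m a b ≠ μ.site r m a' b' := fun h => by rw [h, dist_self] at hd; norm_num at hd
      nlinarith [rc.X'_sep _ hvX _ hv'X hne]

include μ in
/-- **Frame witness for the two columns** («two layerings»): the tents' own axes are parallel, or one of the two stackings is an affine fcc lattice. -/
theorem frameWitness (r : Fin rc.nr) :
    ((rc.tent (rc.rtL r)).L e₃ = (rc.tent (rc.rtR r)).L e₃ ∨ (rc.tent (rc.rtL r)).L e₃ = -((rc.tent (rc.rtR r)).L e₃)) ∨
      (∃ (A : E3 ≃ₗᵢ[ℝ] E3) (u : E3), rc.S (rc.rtL r) ⊆ (fun q => A q + u) '' fccRef) ∨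
      (∃ (A : E3 ≃ₗᵢ[ℝ] E3) (u : E3), rc.S (rc.rtR r) ⊆ (fun q => A q + u) '' fccRef) := by
  obtain ⟨hσL, hσR, hf, hg, -⟩ := μ.rframe_spec r
  rcases axis_parallel_or_affineFcc (rc.tent (rc.rtL r)).hσ hσL hf with hpf | ⟨A, hA⟩
  · rcases axis_parallel_or_affineFcc (rc.tent (rc.rtR r)).hσ hσR hg with hpg | ⟨B, hB'⟩
    · left
      rcases hpf with h1 | h1 <;> rcases hpg with h2 | h2
      · left; rw [h1, h2]
      · right; rw [h1, h2, neg_neg]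
      · right; rw [h1, h2]
      · left; rw [h1, h2]
    · right; right
      refine ⟨B, (rc.tent (rc.rtR r)).s, fun z hz => ?_⟩
      have hz' : z ∈ stacking (rc.tent (rc.rtR r)).L (rc.tent (rc.rtR r)).s (rc.tent (rc.rtR r)).σ := hz
      rw [hB'] at hz'
      exact hz'
  · right; left
    refine ⟨A, (rc.tent (rc.rtL r)).s, fun z hz => ?_⟩
    have hz' : z ∈ stacking (rc.tent (rc.rtL r)).L (rc.tent (rc.rtL r)).s (rc.tent (rc.rtL r)).σ := hz
    rw [hA] at hz'
    exact hz'

/-! ### The claim rule against complete material -/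

variable (ct : (f : Fin rc.ng) → TentCert (rc.tent f)) (τ : Fin rc.nk → ℝ)

/-- **An `f`-CLAIMED box cell does not touch a point near which `g = rtR r` is complete** (radius `2`). -/
theorem false_of_claimed_of_complete_rtR {r : Fin rc.nr} {i : Fin (μ.riserInput ct τ).cells.M}
    (hi : polytope ((μ.riserInput ct τ).cells.Hp i) ⊆ polytope (μ.HB r)) (hf : (μ.riserInput ct τ).grain i = rc.rtL r) {y : E3}
    (hy : y ∈ closure (polytope ((μ.riserInput ct τ).cells.Hp i))) (hcomp : ∀ v ∈ rc.S (rc.rtR r), dist y v ≤ 2 → v ∈ rc.X') : False := by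
  obtain ⟨c, hc, hic⟩ := (μ.grain_box_eq_rtL_iff ct τ hi).1 hf
  obtain ⟨hcX, hcS, hcm⟩ := μ.mem_occF.1 hc
  obtain ⟨m, a, b, hce⟩ := μ.exists_eq_site hcS
  have hl : μ.rlayer r c = m := by rw [hce, μ.rlayer_site]
  rw [hl] at hic hcm
  obtain ⟨hhex, hlo, hhi⟩ := μ.hexagon_of_mem_closure_hexPrism (closure_mono hic hy)
  have hch : μ.rheight r c = (m : ℝ) * hB := by rw [hce, μ.rheight_site]
  have hd1 : dist y c ≤ 1 := μ.dist_le_one_of_hexagon hhex (by rw [hch]; exact μ.abs_sub_le_hB_of_window hlo hhi)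
  obtain ⟨a', b', hd⟩ := μ.exists_siteR_dist_sq hcm a b
  rw [← hce] at hd
  have hd0 := dist_nonneg (x := c) (y := μ.siteR r m a' b')
  have hcv : dist c (μ.siteR r m a' b') ≤ 1 := by nlinarith
  have hv : μ.siteR r m a' b' ∈ rc.X' := hcomp _ (μ.siteR_mem r m a' b') (by
    calc dist y (μ.siteR r m a' b') ≤ dist y c + dist c (μ.siteR r m a' b') := dist_triangle _ _ _
      _ ≤ 2 := by linarith)
  have hne : c ≠ μ.siteR r m a' b' := fun h => by rw [h, dist_self] at hd; norm_num at hd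
  nlinarith [rc.X'_sep c hcX _ hv hne]

/-- **A DEFAULT box cell near complete `f = rtL r`, at a generic boundary point in the closed window of a riser layer, has a HORIZONTAL facet datum**
(`p.1 = ± rn r`): otherwise it would enter the prism of an occupied riser `f`-site and be `f`-claimed. -/
theorem fst_eq_pm_rn_of_complete_rtL {r : Fin rc.nr} {i : Fin (μ.riserInput ct τ).cells.M}
    (hi : polytope ((μ.riserInput ct τ).cells.Hp i) ⊆ polytope (μ.HB r)) (hg : (μ.riserInput ct τ).grain i = rc.rtR r)
    {p : E3 × ℝ} (hp : p ∈ (μ.riserInput ct τ).cells.Hp i) {y : E3} (hy : y ∈ closure (polytope ((μ.riserInput ct τ).cells.Hp i)))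
    (hpy : ⟪p.1, y⟫_ℝ = p.2) (hgen : (μ.riserInput ct τ).Generic p y) (hcomp : ∀ v ∈ rc.S (rc.rtL r), dist y v ≤ 1 → v ∈ rc.X')
    {m : ℤ} (hm : ¬ μ.IsSharedLayer r m) (hlo : μ.govLo r m ≤ μ.rheight r y) (hhi : μ.rheight r y ≤ μ.govHi r m) :
    p.1 = rc.rn r ∨ p.1 = -rc.rn r := by
  -- a cell inside the prism of an occupied layer-`m` `f`-site is `f`-claimed: impossible for the `g`-labelled `i`
  have hclaim : ∀ {c : E3}, c ∈ rc.X' → c ∈ rc.S (rc.rtL r) → μ.rlayer r c = m →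
      polytope ((μ.riserInput ct τ).cells.Hp i) ⊆ polytope (μ.hexPrism r c m) → False := by
    intro c hcX hcS hl hsub
    have hc : c ∈ μ.occF r := μ.mem_occF.2 ⟨hcX, hcS, by rw [hl]; exact hm⟩
    have hf : (μ.riserInput ct τ).grain i = rc.rtL r := (μ.grain_box_eq_rtL_iff ct τ hi).2 ⟨c, hc, by rw [hl]; exact hsub⟩
    exact rc.hrt r (hf.symm.trans hg)
  have h𝓗 : ∀ {c : E3}, c ∈ rc.X' → c ∈ rc.S (rc.rtL r) → μ.rlayer r c = m → μ.hexPrism r c m ⊆ (μ.riserInput ct τ).𝓗 := by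
    intro c hcX hcS hl
    have := μ.hexPrism_subset_𝓗 ct τ (μ.mem_occF.2 ⟨hcX, hcS, by rw [hl]; exact hm⟩)
    rwa [hl] at this
  have hwin : |μ.rheight r y - (m : ℝ) * hB| ≤ hB := μ.abs_sub_le_hB_of_window hlo hhi
  -- the occupied site whose closed hexagon contains `y`
  obtain ⟨a, b, hhex, -⟩ := μ.exists_site_hexagon r m y
  have hcX : μ.site r m a b ∈ rc.X' :=
    hcomp _ (μ.site_mem r m a b) (μ.dist_le_one_of_hexagon hhex (by rw [μ.rheight_site]; exact hwin))
  have hyG := μ.closed_hexPrism_of_hexagon hhex hlo hhi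
  by_cases hap : antip p ∈ μ.hexPrism r (μ.site r m a b) m
  · rcases μ.mem_hexPrism_iff.1 hap with ⟨t, ht⟩ | htop | hbot
    · -- the wall towards the neighbour `c' = c + rL d_t`: `y` is in the closed hexagon of `c'`, and `p` is a wall datum of `G_{c'}`
      exfalso
      have hp' : p = antip (μ.hexWall r (μ.site r m a b) t) := by rw [← ht, antip_antip]
      have hpt : ⟪μ.rL r (sixDir t), y - μ.site r m a b⟫_ℝ = 1 / 2 := by
        rw [hp'] at hpy
        simp only [antip, hexWall, inner_neg_left, neg_inj] at hpy
        rw [inner_sub_right]; linarith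
      obtain ⟨a', b', hc'⟩ := μ.site_add_sixDir r m a b t
      have hhex' : ∀ s, ⟪μ.rL r (sixDir s), y - μ.site r m a' b'⟫_ℝ ≤ 1 / 2 := by
        intro s
        have := hexagon_step (μ.rL r) (y - μ.site r m a b) hhex hpt s
        rwa [sub_sub, hc'] at this
      have hc'X : μ.site r m a' b' ∈ rc.X' :=
        hcomp _ (μ.site_mem r m a' b') (μ.dist_le_one_of_hexagon hhex' (by rw [μ.rheight_site]; exact hwin))
      obtain ⟨t', ht'⟩ := μ.hexWall_shift r (μ.site r m a b) t
      rw [hc', ← ht, antip_antip] at ht'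
      have hpG' : p ∈ μ.hexPrism r (μ.site r m a' b') m := μ.mem_hexPrism_iff.2 (Or.inl ⟨t', ht'.symm⟩)
      have hapG' : antip p ∉ μ.hexPrism r (μ.site r m a' b') m := μ.antip_not_mem_hexPrism (μ.rheight_site r m a' b') hpG'
      exact hclaim hc'X (μ.site_mem r m a' b') (μ.rlayer_site r m a' b')
        ((μ.riserInput ct τ).enter hp hy hgen (h𝓗 hc'X (μ.site_mem r m a' b') (μ.rlayer_site r m a' b'))
          (μ.closed_hexPrism_of_hexagon hhex' hlo hhi) hapG')
    · right
      have h1 := congrArg Prod.fst htop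
      simp only [antip] at h1
      rw [← h1, neg_neg]
    · left
      have h1 := congrArg Prod.fst hbot
      simp only [antip, neg_inj] at h1
      exact h1
  · exfalso
    exact hclaim hcX (μ.site_mem r m a b) (μ.rlayer_site r m a b)
      ((μ.riserInput ct τ).enter hp hy hgen (h𝓗 hcX (μ.site_mem r m a b) (μ.rlayer_site r m a b)) hyG hap)

end Mesh₅

end Summit.Ventures.Crystal3D.Cruxes.TextureLiminf.TexShadow

end
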